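import Summits.BirchSwinnertonDyer.Rank1Residual.Additive.BudgetFromTamagawaCertificatesLayer
import Summits.BirchSwinnertonDyer.Rank1Residual.Additive.SplitMultiplicativeWitnessOfTamagawa
import Summits.BirchSwinnertonDyer.Rank1Residual.Additive.ZpTowerSelmerInfty
import HarnessLib

/-!
# The Route-G budget at level `n` from CENSUS CERTIFICATES over `ℚ` — MAIN: every additive and
# every split-multiplicative Tamagawa row, transport discharged (row T-E3g-BUDn-CERT, FILE 2c = this file, the
# statement of record; seat p10 GEN 5)

HONEST FRAMING (cell `b2b-bsdres`, run/shared/lean/b2b/bsd-rank1-residual/, verbatim in every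
file): the goal of the cell is to DELETE the COMBINATION-SHAPED residual classes of the
Birch–Swinnerton-Dyer formula for ALL analytic-rank `≤ 1` elliptic curves over `ℚ` — "full BSD
formula for every rank `≤ 1` curve in class `C`" assembled STRICTLY from published theorems — so
that the rank-`≤ 1` remainder becomes exactly the CONSTRUCTION-SHAPED classes, which are TYPED
(missing-input `Prop`s), NOT attempted. This is not "finishing BSD". Team n1011 (N10/N11, the
Route-G LOWER budget node of the CONSTRUCTION-SHAPED classes X3♯/X4♯): research route; nothing is
booked by this file; no mark / label moved. THEOREMS ONLY: no definition, no named fact, no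
`sorry`; census certificates enter as HYPOTHESES per row, never as facts.

## What (ROUTE-2 II.17.3 D-n.1 – D-n.3 assembled; referee 1 GEN 16 FLAG-2: statement of record)

FILE 2b (`BudgetFromTamagawaCertificatesLayer`) assembled the ADDITIVE rows over N2; row T-L1-KN
(n1011-p01, `SplitMultiplicativeWitnessOfTamagawa`) supplies the split-multiplicative layer witness
at EVERY split place `v ∤ p` with `p ∣ c_v` modulo A40 ONLY (the Kodaira–Néron converse (L1) being
a tree theorem) — it supersedes FILE 2a's `hμ`-form, which stays as a dominated twin; row T-res
(n1011-p01 / n1011-p17, `ZpTowerSelmerInfty`) supplies N2's transport binder `hres`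
(`ZpTower.exists_selmerInfty_restrictTower_injective`). THIS FILE is the assembly of record:

* MAIN `budgetLeLambdaAt_layer_of_certificates` — `E = W/ℚ` globally minimal, `p` odd,
  `p ∤ #E(ℚ)_tors`, `n : ℕ`, `S` a finite set of places `v` of `ℚ`, each with `v ∤ p`, a
  place-count certificate `v_p(N(v)^{p−1} − 1) = m_v + 1`, `p ∣ c_v` (`localTamagawaNumber` of
  `E ⊗ ℚ_v`), and additive OR split multiplicative reduction at `v`:
  **`BudgetLeLambdaAt p W (Σ_{v ∈ S} p^{min(n, m_v)})`** modulo exactly: Greenberg Prop. 4.14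
  (`h414`), Poitou–Tate duality and the local Euler–Poincaré formula over `ℚ_n` (`hPT`, `hEP`,
  named facts), and Tate's uniformisation A40 (`hU`, used on the multiplicative rows only);
  `budgetLeLambdaAt_layer_of_certificates_of_hres` is the same with the transport kept as a
  binder (for consumers compiled against N2's shape);
* `residualSelmerRankGeAt_layer_of_certificates` — the residual-count twin (plus finiteness of
  `Sel_{p^∞}(E/ℚ_∞)[p]`).

For an odd prime `p` these are ALL the Tamagawa rows with `p ∣ c_v` at `v ∤ p` (non-split
multiplicative: `c_v ∈ {1, 2}`; the hypothesis `hdat` excludes nothing that occurs), so for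
`n ≥ max_v m_v` the bound is r2's `B(E,p) = Σ_v p^{m_v}` (ST-17.5, the identification with the
census being EVIDENCE). HONEST LIMITS: one inequality per layer `n`; named facts as listed.

References: R. Greenberg, LNM 1716 (1999) §5 pp. 114–118 and Prop. 4.14 [GreenbergLNM1716];
J. H. Silverman, *ATAEC* V.3, V.5 and Ex. 5.13 [SilvermanATAEC1994]; L. C. Washington,
*Introduction to Cyclotomic Fields* §13.1, Prop. 13.2 [Washington1997]; ROUTE-2 II.17
(cells/n1011/).
-/

set_option autoImplicit false

noncomputable section

open scoped Classical

open Function Field NumberField IsDedekindDomain WeierstrassCurve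
open Literature.NumberTheory.EllipticCurves Literature.NumberTheory.GaloisRepresentations
open Literature.NumberTheory.GaloisRepresentations.DiscreteGaloisModule (unramifiedSubgroup)
open Literature.NumberTheory.GaloisCohomology

namespace Summit.BirchSwinnertonDyer.Rank1Residual.Additive

variable {W : WeierstrassCurve ℚ} [W.IsElliptic] [W.IsGloballyMinimal] {p : ℕ} [hp : Fact p.Prime]

/-- **The layer witness on a Tamagawa row** (additive OR split multiplicative at `v ∤ p`,
`p ∣ c_v`), at every place `w ∣ v` of the layer `ℚ_n` of any `ℤ_p`-extension: FILE 2a's additive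
witness / row T-L1-KN's split-multiplicative witness (A40 on the multiplicative branch only).
[cite: GreenbergLNM1716, §2 p. 74, §3 p. 74 and §5 (406D1)]
[cite: SilvermanATAEC1994, Ch. V Thm. 3.1 (c),(d), Thm. 5.3 (a),(b) and Ex. 5.13] -/
theorem exists_mem_unramifiedSubgroup_not_mem_kummerLocalConditionAt_layer_of_tamagawaRow
    (hU : Silverman1994_thmV53_tateUniformisation.{0}) (hodd : p ≠ 2) (κ : ZpExtension ℚ p)
    (n : ℕ) {v : HeightOneSpectrum (𝓞 ℚ)} (hpv : ((p : ℕ) : 𝓞 ℚ) ∉ v.asIdeal)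
    (hcv : p ∣ (W.baseChange (v.adicCompletion ℚ)).localTamagawaNumber (v.adicCompletionIntegers ℚ))
    (hdat : W.HasAdditiveReductionAt v ∨ W.HasSplitMultiplicativeReductionAt v)
    (w : HeightOneSpectrum (𝓞 (κ.layer n))) (hw : w.under (𝓞 ℚ) = v) :
    ∃ u ∈ unramifiedSubgroup
        (((W.baseChange (κ.layer n)).torsionGaloisModule (p : ℤ)).restrictField
          (w.adicCompletion (κ.layer n))) 1,
      u ∉ (W.baseChange (κ.layer n)).kummerLocalConditionAt (p : ℤ)
        (w.adicCompletion (κ.layer n)) := by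
  rcases hdat with hadd | hsplit
  · exact exists_mem_unramifiedSubgroup_not_mem_kummerLocalConditionAt_layer_of_hasAdditiveReductionAt
      W κ n hpv hodd hadd hcv w hw
  · exact exists_mem_unramifiedSubgroup_not_mem_kummerLocalConditionAt_baseChange_of_split_of_dvd_localTamagawaNumber'
      W p w hU hpv hsplit hcv hw

/-- **T-E3g-BUDn-CERT MAIN with the transport kept as a binder** (for consumers compiled against
N2's `hres` shape): `BudgetLeLambdaAt p W (Σ_{v ∈ S} p^{min(n, m_v)})` from the census
certificates on every additive and every split-multiplicative Tamagawa row `v ∈ S`.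
[cite: GreenbergLNM1716, §5 pp. 114–118 and Prop. 4.14] [cite: Washington1997, §13.1 and Prop. 13.2]
[cite: SilvermanATAEC1994, Ch. V Thm. 3.1 (c),(d), Thm. 5.3 (a),(b) and Ex. 5.13] -/
theorem budgetLeLambdaAt_layer_of_certificates_of_hres (hodd : p ≠ 2)
    (h414 : Greenberg1999.prop414_noFiniteSubmodule_of_not_dvd_torsionOrder)
    (htors : ¬ p ∣ W.torsionOrder) (hU : Silverman1994_thmV53_tateUniformisation.{0}) (n : ℕ)
    (hres : ∀ (κ : ZpExtension ℚ p) [NumberField (κ.layer n)], κ.IsCyclotomic →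
      ∃ κ' : ZpExtension (κ.layer n) p,
        (∀ σ : absoluteGaloisGroup (κ.layer n),
          (κ' σ).toAdd * (p : ℤ_[p]) ^ n = (κ (resGal (K := ℚ) (κ.layer n) σ)).toAdd) ∧
        ∃ f : (W.baseChange (κ.layer n)).selmerInfty κ' →+ W.selmerInfty κ, Injective f)
    (hPT : ∀ (κ : ZpExtension ℚ p) [NumberField (κ.layer n)], κ.IsCyclotomic →
      poitouTate_selmerStructure_duality (κ.layer n))
    (hEP : ∀ (κ : ZpExtension ℚ p) [NumberField (κ.layer n)], κ.IsCyclotomic →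
      ∀ w : HeightOneSpectrum (𝓞 (κ.layer n)),
      localEulerPoincareCharacteristic (w.adicCompletion (κ.layer n)))
    (S : Finset (HeightOneSpectrum (𝓞 ℚ))) (m : HeightOneSpectrum (𝓞 ℚ) → ℕ)
    (hSp : ∀ v ∈ S, ((p : ℕ) : 𝓞 ℚ) ∉ v.asIdeal)
    (hval : ∀ v ∈ S, padicValNat p (v.residueCard ^ (p - 1) - 1) = m v + 1)
    (hcv : ∀ v ∈ S,
      p ∣ (W.baseChange (v.adicCompletion ℚ)).localTamagawaNumber (v.adicCompletionIntegers ℚ))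
    (hdat : ∀ v ∈ S, W.HasAdditiveReductionAt v ∨ W.HasSplitMultiplicativeReductionAt v) :
    BudgetLeLambdaAt p W (∑ v ∈ S, p ^ min n (m v)) :=
  budgetLeLambdaAt_layer_of_padicValNat hodd h414 htors n hres hPT hEP S m hSp hval
    fun v hv κ _ w hw ↦
      exists_mem_unramifiedSubgroup_not_mem_kummerLocalConditionAt_layer_of_tamagawaRow hU hodd κ n
        (hSp v hv) (hcv v hv) (hdat v hv) w hw

/-- **T-E3g-BUDn-CERT, MAIN (statement of record): the Route-G budget at level `n` from census
certificates over `ℚ`.** Let `E = W/ℚ` be globally minimal, `p` an odd prime with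
`p ∤ #E(ℚ)_tors`, `n : ℕ`, and `S` a finite set of places `v` of `ℚ`, each carrying: `v ∤ p`; a
place-count certificate `v_p(N(v)^{p−1} − 1) = m_v + 1`; `p ∣ c_v` (`localTamagawaNumber` of
`E ⊗ ℚ_v`); additive OR split multiplicative reduction at `v`.  Then, modulo the named facts
Greenberg Prop. 4.14 (`h414`), Poitou–Tate duality over `ℚ_n` (`hPT`), the local Euler–Poincaré
formula at the places of `ℚ_n` (`hEP`) and Tate's uniformisation A40 (`hU`, multiplicative rows
only): **`BudgetLeLambdaAt p W (Σ_{v ∈ S} p^{min(n, m_v)})`**, i.e. `λ(X(E/ℚ_∞)) ≥ Σ_v p^{min(n, m_v)}`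
for every torsion Selmer-dual datum with `μ = 0`.  N2's `hres`, `hwitn` and `b` are ALL discharged
(rows T-res, T-E3g-ADD, T-BUD5-K, T-L1-KN, T-E3g-BUDn-K by name); for `n ≥ max_v m_v` the bound
is `Σ_v p^{m_v}`.  Image-free; additive reduction at `p` allowed; one inequality per layer.
[cite: GreenbergLNM1716, §5 pp. 114–118 and Prop. 4.14] [cite: Washington1997, §13.1 and Prop. 13.2]
[cite: SilvermanATAEC1994, Ch. V Thm. 3.1 (c),(d), Thm. 5.3 (a),(b) and Ex. 5.13] -/
theorem budgetLeLambdaAt_layer_of_certificates (hodd : p ≠ 2)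
    (h414 : Greenberg1999.prop414_noFiniteSubmodule_of_not_dvd_torsionOrder)
    (htors : ¬ p ∣ W.torsionOrder) (hU : Silverman1994_thmV53_tateUniformisation.{0}) (n : ℕ)
    (hPT : ∀ (κ : ZpExtension ℚ p) [NumberField (κ.layer n)], κ.IsCyclotomic →
      poitouTate_selmerStructure_duality (κ.layer n))
    (hEP : ∀ (κ : ZpExtension ℚ p) [NumberField (κ.layer n)], κ.IsCyclotomic →
      ∀ w : HeightOneSpectrum (𝓞 (κ.layer n)),
      localEulerPoincareCharacteristic (w.adicCompletion (κ.layer n)))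
    (S : Finset (HeightOneSpectrum (𝓞 ℚ))) (m : HeightOneSpectrum (𝓞 ℚ) → ℕ)
    (hSp : ∀ v ∈ S, ((p : ℕ) : 𝓞 ℚ) ∉ v.asIdeal)
    (hval : ∀ v ∈ S, padicValNat p (v.residueCard ^ (p - 1) - 1) = m v + 1)
    (hcv : ∀ v ∈ S,
      p ∣ (W.baseChange (v.adicCompletion ℚ)).localTamagawaNumber (v.adicCompletionIntegers ℚ))
    (hdat : ∀ v ∈ S, W.HasAdditiveReductionAt v ∨ W.HasSplitMultiplicativeReductionAt v) :
    BudgetLeLambdaAt p W (∑ v ∈ S, p ^ min n (m v)) :=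
  budgetLeLambdaAt_layer_of_certificates_of_hres hodd h414 htors hU n
    (fun κ _ _ ↦ ZpTower.exists_selmerInfty_restrictTower_injective W κ n) hPT hEP S m hSp hval
    hcv hdat

/-- **The residual count at level `n` from census certificates** (twin of the MAIN, transport
discharged; plus finiteness of `Sel_{p^∞}(E/ℚ_∞)[p]`):
`ResidualSelmerRankGeAt p W (Σ_{v ∈ S} p^{min(n, m_v)})`. [cite: GreenbergLNM1716, §5 pp. 114–118]
[cite: Washington1997, §13.1] [cite: SilvermanATAEC1994, Ch. V Thm. 3.1 (c),(d), Thm. 5.3 (a),(b) and Ex. 5.13] -/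
theorem residualSelmerRankGeAt_layer_of_certificates (hodd : p ≠ 2)
    (htors : ¬ p ∣ W.torsionOrder) (hU : Silverman1994_thmV53_tateUniformisation.{0}) (n : ℕ)
    (hfin : ∀ (κ : ZpExtension ℚ p), κ.IsCyclotomic → Finite {s : W.selmerInfty κ // p • s = 0})
    (hPT : ∀ (κ : ZpExtension ℚ p) [NumberField (κ.layer n)], κ.IsCyclotomic →
      poitouTate_selmerStructure_duality (κ.layer n))
    (hEP : ∀ (κ : ZpExtension ℚ p) [NumberField (κ.layer n)], κ.IsCyclotomic →
      ∀ w : HeightOneSpectrum (𝓞 (κ.layer n)),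
      localEulerPoincareCharacteristic (w.adicCompletion (κ.layer n)))
    (S : Finset (HeightOneSpectrum (𝓞 ℚ))) (m : HeightOneSpectrum (𝓞 ℚ) → ℕ)
    (hSp : ∀ v ∈ S, ((p : ℕ) : 𝓞 ℚ) ∉ v.asIdeal)
    (hval : ∀ v ∈ S, padicValNat p (v.residueCard ^ (p - 1) - 1) = m v + 1)
    (hcv : ∀ v ∈ S,
      p ∣ (W.baseChange (v.adicCompletion ℚ)).localTamagawaNumber (v.adicCompletionIntegers ℚ))
    (hdat : ∀ v ∈ S, W.HasAdditiveReductionAt v ∨ W.HasSplitMultiplicativeReductionAt v) :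
    ResidualSelmerRankGeAt p W (∑ v ∈ S, p ^ min n (m v)) :=
  residualSelmerRankGeAt_layer_of_padicValNat hodd htors n hfin
    (fun κ _ _ ↦ ZpTower.exists_selmerInfty_restrictTower_injective W κ n) hPT hEP S m hSp hval
    fun v hv κ _ w hw ↦
      exists_mem_unramifiedSubgroup_not_mem_kummerLocalConditionAt_layer_of_tamagawaRow hU hodd κ n
        (hSp v hv) (hcv v hv) (hdat v hv) w hw

end Summit.BirchSwinnertonDyer.Rank1Residual.Additive

end
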